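import Mathlib
import HarnessLib
import Summits.HubbardSuperconductivity.HubbardSuperconductivity.Theorems.KLProgrammeC4aLevelChart

/-!
# Route `KLProgramme` — crux C4a: the co-moving chart is INJECTIVE on the tube (prerequisite of the 2-D change of variables of (L2))

Cell `gate-hubbard-kl`, lane hubbard-kl-c4a-1; helper for the engine-flow child `KLRegimeEngineV17F2` (stmt-HubbardSuperconductivity-20437), stub (C).
`levelPoint μ K ρ ϑ = u_K(μ+ρ; ϑ)·(cos ϑ, sin ϑ)` with `u > 0`; the level is recovered by the frame band (`frameLevel_levelPoint`) and the angle, modulo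
`2π`, by the direction.  Hence `(ρ, ϑ) ↦ levelPoint μ K ρ ϑ` is injective on `{ρ : [μ+ρ−A, μ+ρ+A] ⊂ [a,b]} × (−π, π]` — what Mathlib's
`integral_image_eq_integral_abs_det_fderiv_smul` will need for the momentum-space ↔ chart change of variables (C4A-PLAN §9 (L2)).

* `levelPoint_apply_zero/one` (components `u cos ϑ`, `u sin ϑ`), `levelRadius_pos`, `levelPoint_injOn`.

Theorems only; nothing is asserted about the Hubbard model.  [cite: BenfattoGiulianiMastropietro2006] (§2.4: the polar graph of the curve).
-/

noncomputable section

namespace Summit.HubbardSuperconductivity.HubbardSuperconductivity.Theorems.C4a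

set_option linter.dupNamespace false -- summit = problem name (single-conjunct summit), D-0017

open Real Set
open Literature.MathematicalPhysics.QuantumLattice Literature.MathematicalPhysics.QuantumLattice.BandSectorCounting
open Summit.HubbardSuperconductivity.HubbardSuperconductivity.Theorems.DispersionFlow
open Summit.HubbardSuperconductivity.HubbardSuperconductivity.Theorems.KLRegimeSplit
open Summit.HubbardSuperconductivity.HubbardSuperconductivity.Theorems.PerturbedFermiCurve

/-- First component of the chart point: `u·cos ϑ`. -/
theorem levelPoint_apply_zero (μ : ℝ) (K : TrigPolyC4v) (ρ ϑ : ℝ) :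
    levelPoint μ K ρ ϑ 0 = perturbedFermiRadius (fun k : Fin 2 → ℝ => -K.eval k) (μ + ρ) ϑ * Real.cos ϑ := by
  simp [levelPoint, klFermiPoint, dir]

/-- Second component of the chart point: `u·sin ϑ`. -/
theorem levelPoint_apply_one (μ : ℝ) (K : TrigPolyC4v) (ρ ϑ : ℝ) :
    levelPoint μ K ρ ϑ 1 = perturbedFermiRadius (fun k : Fin 2 → ℝ => -K.eval k) (μ + ρ) ϑ * Real.sin ϑ := by
  simp [levelPoint, klFermiPoint, dir]

section Inj

variable {a b : ℝ} (B : BandBounds a b) {K : TrigPolyC4v} {A : ℝ}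
  (hA : ∀ p : Momentum, ∀ j ≤ 2, ‖iteratedFDeriv ℝ j (frameShift K) p‖ ≤ A)
include B hA

/-- The level radius is positive: `0 < u_K(μ + ρ; ϑ)` whenever `[μ + ρ − A, μ + ρ + A] ⊂ [a, b]`. -/
theorem levelRadius_pos {μ ρ : ℝ} (hlo : a ≤ μ + ρ - A) (hhi : μ + ρ + A ≤ b) (ϑ : ℝ) :
    0 < perturbedFermiRadius (fun k : Fin 2 → ℝ => -K.eval k) (μ + ρ) ϑ := by
  have hδ : ∀ k : Fin 2 → ℝ, (∀ i, |k i| ≤ π) → |(fun p : Fin 2 → ℝ => -K.eval p) k| ≤ A := fun k _ => by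
    simpa [frameShift_toLp] using abs_frameShift_toLp_le hA k
  have hroot := isBandFermiRadius_klFermiRadius B hA hlo hhi ϑ
  exact (mem_Ioo_of_shifted B hδ hlo hhi hroot).1

/-- **The chart is injective on the tube**: if `[μ + ρᵢ − A, μ + ρᵢ + A] ⊂ [a, b]` and `ϑᵢ ∈ (−π, π]` (`i = 1, 2`), then
`levelPoint μ K ρ₁ ϑ₁ = levelPoint μ K ρ₂ ϑ₂` forces `ρ₁ = ρ₂` (the frame band reads the level) and `ϑ₁ = ϑ₂` (the direction of a vector of
positive length reads the angle modulo `2π`). -/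
theorem levelPoint_injOn {μ ρ₁ ρ₂ ϑ₁ ϑ₂ : ℝ} (hlo₁ : a ≤ μ + ρ₁ - A) (hhi₁ : μ + ρ₁ + A ≤ b) (hlo₂ : a ≤ μ + ρ₂ - A)
    (hhi₂ : μ + ρ₂ + A ≤ b) (hϑ₁ : ϑ₁ ∈ Ioc (-π) π) (hϑ₂ : ϑ₂ ∈ Ioc (-π) π)
    (h : levelPoint μ K ρ₁ ϑ₁ = levelPoint μ K ρ₂ ϑ₂) : ρ₁ = ρ₂ ∧ ϑ₁ = ϑ₂ := by
  -- the level
  have hρ : ρ₁ = ρ₂ := by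
    have h1 := frameLevel_levelPoint B hA hlo₁ hhi₁ ϑ₁
    have h2 := frameLevel_levelPoint B hA hlo₂ hhi₂ ϑ₂
    rw [h] at h1
    linarith
  subst hρ
  refine ⟨rfl, ?_⟩
  -- the radius: both points have the same components
  set u₁ := perturbedFermiRadius (fun k : Fin 2 → ℝ => -K.eval k) (μ + ρ₁) ϑ₁ with hu₁
  set u₂ := perturbedFermiRadius (fun k : Fin 2 → ℝ => -K.eval k) (μ + ρ₁) ϑ₂ with hu₂
  have hpos₁ : 0 < u₁ := levelRadius_pos B hA hlo₁ hhi₁ ϑ₁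
  have hpos₂ : 0 < u₂ := levelRadius_pos B hA hlo₁ hhi₁ ϑ₂
  have hc : u₁ * Real.cos ϑ₁ = u₂ * Real.cos ϑ₂ := by
    have := congrArg (fun q : Momentum => q 0) h
    simpa [levelPoint_apply_zero] using this
  have hs : u₁ * Real.sin ϑ₁ = u₂ * Real.sin ϑ₂ := by
    have := congrArg (fun q : Momentum => q 1) h
    simpa [levelPoint_apply_one] using this
  -- equal radii
  have hsq : u₁ ^ 2 = u₂ ^ 2 := by
    have e1 : u₁ ^ 2 = (u₁ * Real.cos ϑ₁) ^ 2 + (u₁ * Real.sin ϑ₁) ^ 2 := by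
      nlinarith [Real.cos_sq_add_sin_sq ϑ₁]
    have e2 : u₂ ^ 2 = (u₂ * Real.cos ϑ₂) ^ 2 + (u₂ * Real.sin ϑ₂) ^ 2 := by
      nlinarith [Real.cos_sq_add_sin_sq ϑ₂]
    rw [e1, e2, hc, hs]
  have hu : u₁ = u₂ := by
    have := (sq_eq_sq₀ hpos₁.le hpos₂.le).1 hsq
    exact this
  -- equal angles modulo 2π, hence equal in (−π, π]
  have hcos : Real.cos ϑ₁ = Real.cos ϑ₂ := by
    have : u₁ * Real.cos ϑ₁ = u₁ * Real.cos ϑ₂ := by rw [hc, hu]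
    exact mul_left_cancel₀ hpos₁.ne' this
  have hsin : Real.sin ϑ₁ = Real.sin ϑ₂ := by
    have : u₁ * Real.sin ϑ₁ = u₁ * Real.sin ϑ₂ := by rw [hs, hu]
    exact mul_left_cancel₀ hpos₁.ne' this
  have hang : (ϑ₁ : Real.Angle) = (ϑ₂ : Real.Angle) := Real.Angle.cos_sin_inj hcos hsin
  have h1 : (ϑ₁ : Real.Angle).toReal = ϑ₁ := Real.Angle.toReal_coe_eq_self_iff.2 ⟨hϑ₁.1, hϑ₁.2⟩
  have h2 : (ϑ₂ : Real.Angle).toReal = ϑ₂ := Real.Angle.toReal_coe_eq_self_iff.2 ⟨hϑ₂.1, hϑ₂.2⟩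
  rw [← h1, ← h2, hang]

end Inj

end Summit.HubbardSuperconductivity.HubbardSuperconductivity.Theorems.C4a
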